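import Summits.Parity.BatemanHorn.Theorems.BalancedSemiprimeLayer.Negative.TightAtX

/-!
# `BalancedSemiprimeLayer` (crux stmt-Parity-9469): `pairwise_not_associated` is load-bearing

Negative-side load-bearing analysis (cdisprove, refuter-cdisprove-stmt-Parity-9469-g2-0), PROVED:
the crux with the hypothesis `pairwise_not_associated` of `IsBatemanHornSystem` DROPPED is FALSE.
Witness: the duplicated system `(X, X)` (irreducible members, positive leading coefficients, no
fixed prime divisor). Its crux count is the rough count `Φ(x, x^{(1−δ)/2})` of `(X)` and its prime
count is `π(x)`, so the excess is the `(X)`-layer `∼ log((1+δ)/(1−δ))·x/log x` (`tendsto_layer_X`),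
while the tolerance is the `k = 2` one, `ε·x/(log x)²`. So ANY proof of the crux must use
`pairwise_not_associated`: the tolerance exponent `k` is tight against duplicated coordinates.
-/

namespace Summit.Parity.BatemanHorn.Theorems.BalancedSemiprimeLayer.Negative

open Filter Finset Polynomial Real
open scoped Topology
open Literature.NumberTheory.Sieve

/-- `(X, X)` has no fixed prime divisor (`ω(p) = 1`). [folklore] -/
theorem hasNoFixedPrimeDivisor_X_X : HasNoFixedPrimeDivisor ![(X : ℤ[X]), X] := by
  intro p hp
  unfold polyRootCountMod
  simp only [Fin.prod_univ_two, Matrix.cons_val_zero, Matrix.cons_val_one, eval_X]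
  rw [card_filter_range_dvd_mul_self hp]
  exact hp.one_lt

/-- **Any proof of the crux must use `pairwise_not_associated`**: with that hypothesis dropped the
statement is false (witness `(X, X)`, `ε = 1`). [folklore] -/
theorem balancedSemiprimeLayer_false_without_notAssociated :
    ¬ ∀ (k : ℕ) (f : Fin k → ℤ[X]), (∀ i, Irreducible (f i)) → (∀ i, 0 < (f i).leadingCoeff) →
      HasNoFixedPrimeDivisor f → ∀ ε : ℝ, 0 < ε → ∃ δ : ℝ, 0 < δ ∧ δ ≤ 1 / 4 ∧
        ∀ᶠ x : ℕ in atTop,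
          (((Icc 1 x).filter (fun n : ℕ => ∀ i, 0 < (f i).eval (n : ℤ) ∧
            ∀ p ∈ range ⌈(x : ℝ) ^ (((f i).natDegree : ℝ) * (1 - δ) / 2)⌉₊,
              p.Prime → ¬ ((p : ℤ) ∣ (f i).eval (n : ℤ)))).card : ℝ) ≤
            (polyPrimeCount f x : ℝ) + ε * (x : ℝ) / Real.log x ^ k := by
  intro h
  have hirr : ∀ i, Irreducible (![(X : ℤ[X]), X] i) := by
    intro i; fin_cases i <;> exact irreducible_X
  have hlc : ∀ i, 0 < (![(X : ℤ[X]), X] i).leadingCoeff := by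
    intro i; fin_cases i <;> simp
  obtain ⟨δ, hδ0, hδ, hev⟩ := h 2 ![X, X] hirr hlc hasNoFixedPrimeDivisor_X_X 1 one_pos
  have hgt := eventually_mul_div_log_pow_lt (tendsto_layer_X hδ0.le hδ)
    (log_ratio_pos hδ0 (by linarith)) 1 (le_refl 2)
  obtain ⟨x, h1, h2⟩ := (hev.and hgt).exists
  rw [card_cruxFilter_X_X, polyPrimeCount_X_X] at h1
  linarith

end Summit.Parity.BatemanHorn.Theorems.BalancedSemiprimeLayer.Negative
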